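import Literature.AlgebraicGeometry.GroupSchemes.CartierDualAnnihilatorOfDuality
import Literature.AlgebraicGeometry.GroupSchemes.CartierDualBlockReduction
import Literature.AlgebraicGeometry.Motives.AbelianVarietyFrobeniusKernelTorsion
import Literature.AlgebraicGeometry.Motives.AbelianVarietyFrobeniusKernelBlocks
import HarnessLib

/-!
# ★ RE-HOME (rung 0, GENERIC → Literature; director g27 s1336 (R1)) of `Lines/F0_P6b_FrobeniusLagrangian.lean` (tree sha16 f2b6c542f6c16a3d, 179 l.)

Target `Literature/AlgebraicGeometry/Motives/AbelianVarietyFrobeniusBlockLagrangian.lean`.  CODE BYTES = the Lines workfile's, except: the namespace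
`Summit.HodgeConjecture.HodgeConjecture.Cruxes.HLiu418.F0P6bFrobeniusLagrangian` becomes `Literature.AlgebraicGeometry.Motives.AbelianVarietyFrobeniusBlockLagrangian` (this file mentions no `Summit.` constant and imports
Literature ★ only — it is generic algebraic geometry), and the Summit `dupNamespace` option line is dropped.  Every short name is unchanged; the
`Lines/` original stays untouched until the LEAD's SHIM word, when it becomes `import` + `export Literature.AlgebraicGeometry.Motives.AbelianVarietyFrobeniusBlockLagrangian (…)` under the old
namespace (alias shim, lean-checked `F0/P6/L7/LA7-plan/g4/rehome/alias_shim_test.LA7-plan-g4.lean`).  Count-neutral: HC_CM is proved only modulo the 7 printed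
citations (2 remaining: hLiu418 = stmt-HodgeConjecture-24832, h413 = stmt-HodgeConjecture-24833) until rung 0 closes.  (LA7-plan (g4), 2026-09-02.)

Original module docstring (verbatim) follows.
-/

/-!
# Crux `HLiu418` — P6 «MOD programme», door P″ — SUB-LINE **F0-P6b FrobeniusLagrangian** (CANDIDATE ED. 1 v4, statement-first, junk-proof (ρB); SORRY-FREE — (BR) PAID by ★ p846608)
# «the Frobenius kernel `A[F_q] ⊂ A[q]` is LAGRANGIAN for the scheme-theoretic `λ`-Weil pairing» — the organ behind the (R-2) ∕ σ2-G4
# BIG-block Frobenius law `Ker F_q ∩ 𝒯(z̄)[w^∞] = [ϖ^{d−1}]⁻¹(sp N)`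

SKELETON (F0P6b-plan (g3), 2026-09-01).  Cell `hodgecm-mathlib`, floor 0 (D-0183) ∕ D-0175 «LINES FIRST», programme P6, crux item
stmt-HodgeConjecture-24832 (`HCCMUnconditional.HLiu418`).  GENERIC: imports ★ `Literature` only (no `Summits` parent, o-6-safe); nothing in this
file is about HC.  HC_CM is proved only modulo the printed citations until rung 0 closes; this file changes no count.

## Why (memo `F0/P6/F0P6b-plan/g3/MEMO-R2-BigBlockLagrangian.v1.F0P6b-plan-g3.md` ed85a2d9580f6a33)
The P6a datum's named remainder (R-2) (Defs v0.4b∕c module docstring) and the σ2 kit's gap G4 («`Ker F_q = q̄⁻¹(B̄[𝔠])`, ONE inclusion + ranks»)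
need, on the `(2d−1)`-dimensional block `W` of `A_x̄[p^∞]`, the law `Ker F_q ∩ W = [ϖ̄^{d−1}]⁻¹((kerF x̄)^{⊥,ϖ})`.  Duality-free routes do not reach
`W` for `d ≥ 2` (`W ⊇ (LT)^∨`, biconnected of dimension `d−1`; the tree's formal-module kernels are one-dimensional).  The law IS Cartier–Weil
duality: **(LAG) `A[F_q]^⊥ = A[F_q]` in `A[q]`** under the `λ`-Weil duality `e_λ : A[q] ≅ A[q]^D`, which is Rosati-HERMITIAN
(`e ∘ ι(ā) = ι(a)^D ∘ e`), hence pairs the `u`-block with the `ū`-block; so `Ker F_q ∩ W = (Ker F_q ∩ 𝒢)^⊥ ∩ W` with `𝒢` the one-dimensional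
block and `Ker F_q ∩ 𝒢 = kerF x̄` (D3).  PRINT: [MumfordAV1970] §15 Thm. 1 (`Ker f^∨ ≅ (Ker f)^D`, `e_f`), §20 pp. 186–189 (`e_λ`, Rosati
adjointness (I) p. 189), §23; [Oda1969] Thm. 1.1 ∕ Cor. 1.3 (`⟨F x, y⟩ = ⟨x, V y⟩`: `(Ker F)^⊥ = Ker(V^∨) = Ker F_{Â}` since `[q] = V ∘ F` and
★ (DF) `(F_A)^∨ = V_Â` p845410); [EdixhovenVanDerGeerMoonenAV] (5.21), (7.34).

## Registered stub and head (ED. 1 v3 — re-cut (ρB) after F0P6-ref1 (g2) LIGHT BOX o-10, 19:19:22Z: v2's (LAG) and (BLF) were FALSE AS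
## TYPED — junk `star`∕`act` with no polarization; (BR) TRUE as typed)
* `stub_BR : BlockReduction` — **(BR) «BLOCK REDUCTION OF A LAGRANGIAN»**, GENERIC finite-group-scheme algebra (no abelian variety), **CLOSED-PROVED**
  in v4 by the ★ organ `Literature/AlgebraicGeometry/GroupSchemes/CartierDualBlockReduction.lean` (B-p04 (g38), p846608, 2026-09-01T19:57Z;
  `AffineGroupScheme.blockReduction`, body token-identical to `BlockReduction`) — the socket name is KEPT so the head text is unchanged; TRUE as typed
  (ref1 read-through 19:19:22Z): a self-annihilating closed sublayer `Φ` of a layer `G` with perfect duality `e`, two idempotent layer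
  endomorphisms mutually ADJOINT for `e`, `Φ` stable under one of them ⟹ `e` induces a perfect duality `eW : W ≅ (𝒢l)^D` between the two fixed
  layers and «the `W`-part of `Φ` is the `eW`-annihilator of `Φ ∩ 𝒢l`».  Why it might fail: only through typing (junk idempotents `0`, `𝟙` are
  harmless: the conclusion degenerates with them).  Sources: [Tate1997FiniteFlatGroupSchemes §(3.8)], [MumfordAV1970 §20 (I)].  S–M.
* HEAD `blockLagrangianFrobenius_of_line : BlockReduction → BlockLagrangianFrobenius` (sorry-free): the consumer shape (BLF) is JUNK-PROOF BY
  CONSTRUCTION — it takes the hermitian Lagrangian duality `(e₀, hherm₀, hlag₀)` of the `q`-torsion layer as HYPOTHESES (ref1 (ρB)) and proves the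
  `W`-block Frobenius law from (BR) plus the ★ (BLK-nat) stability of `A[F_q]` under `ι(εu)` (`AbelianVariety.comp_end_comp_relFrobenius_eq_one`,
  proved inline — no stability hypothesis).
* NOT A STUB HERE (organ card row, A-lane, L): **(CN′)+(ISO-F) «the `λ`-WEIL DUALITY SUPPLIER»** — for an `O`-compatible polarization `λ` of degree
  prime to `p` with Rosati involution `star` on `ι(O)`: THE Weil duality `e_λ : A[q] ≅ A[q]^D` is a homomorphism, hermitian
  (`ι(star a)|_{A[q]} ≫ e_λ = e_λ ≫ (ι(a)|_{A[q]})^D`) and `A[F_q]^{⊥} = A[F_q]` ([MumfordAV1970] §15 Thm 1 `Ker f^∨ ≅ (Ker f)^D`, §20 (I) p. 189,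
  §23; [Oda1969] Cor 1.3 `F^D = V`, `[q] = V∘F`; ★ (DF) `AbelianSchemes/DualIsogenyRelFrobenius` p845410; parents ★ `DualIsogenyKernel`,
  `PoincareStabilizerDualKernel`, `AbelianSchemeQuotientDualPair*`, `CartierDualQuotient` p846266) — it DISCHARGES the three hypotheses of (BLF);
  typed in abelian-variety currency (ρA) by its taker, never as the junk-admitting layer statement of v2.
-/

set_option autoImplicit false

-- Mathlib's `Over`/`Scheme` APIs are stated across semireducible wrappers (as in the ★ `GroupSchemes/*` files this skeleton imports).
set_option backward.isDefEq.respectTransparency false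

noncomputable section

universe u

open CategoryTheory CategoryTheory.Limits AlgebraicGeometry MonoidalCategory CartesianMonoidalCategory
open scoped MonObj
open Literature.AlgebraicGeometry.GroupSchemes Literature.AlgebraicGeometry.GroupSchemes.GroupSchemeKernel
open Literature.AlgebraicGeometry.GroupSchemes.AffineGroupScheme
open Literature.AlgebraicGeometry.Motives Literature.AlgebraicGeometry.Motives.AbelianVariety

namespace Literature.AlgebraicGeometry.Motives.AbelianVarietyFrobeniusBlockLagrangian

/-! ## §1 The letter (closed named `Prop`, LAYER currency) -/

/-- **(BR) «BLOCK REDUCTION OF A LAGRANGIAN» — generic finite-group-scheme algebra, no abelian variety.**  Data: an affine commutative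
layer `G` over a field with a perfect duality `e : G ≅ G^D` (a homomorphism); a closed sublayer `φ : Φ ↪ G` which is its OWN ANNIHILATOR
(points form); two layer endomorphisms `εW`, `ε𝒢` (the conjugate block idempotents `ι(ε_ū)`, `ι(ε_u)`), idempotent and MUTUALLY ADJOINT for
`e` (`⟨ε𝒢 x, y⟩ = ⟨x, εW y⟩` and `⟨εW x, y⟩ = ⟨x, ε𝒢 y⟩`, the intertwining shape of ★ `exists_comp_eq_comp_of_stable_of_intertwines`);
`Φ` stable under `ε𝒢`; the fixed layers `jW : W ↪ G` of `εW` and `j𝒢 : 𝒢l ↪ G` of `ε𝒢` (the two blocks) and a realisation `φ𝒢 : Φ𝒢 ↪ 𝒢l` of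
`Φ ∩ 𝒢l`.  Conclusion: `e` induces a perfect duality `eW : W ≅ (𝒢l)^D` between the two blocks, and **the `W`-part of `Φ` is the
`eW`-annihilator of `Φ ∩ 𝒢l`**: a `T`-point `x` of `W` lies in `(Φ ∩ 𝒢l)^{⊥_{eW}}` iff `x` lies in `Φ`.  (S–M: `e(x)` for `x ∈ W` is an
`ε𝒢`-invariant character, so it is trivial on `Φ` iff trivial on `ε𝒢 Φ = Φ ∩ 𝒢l`; perfectness of `eW` from the two adjunctions and ranks,
★ `CartierDualAnnihilatorOfDuality` §2–§3, ★ `KernelRecognitionByRank`.) [cite: Tate1997FiniteFlatGroupSchemes, §(3.8) pp. 145–146]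
[cite: MumfordAV1970, §20 (I) (p. 189)] -/
def BlockReduction : Prop :=
  ∀ ⦃k : Type u⦄ [Field k]
    (G : SchemeOver k) [GrpObj G] [IsCommMonObj G] [IsAffine G.left] [Module.Free k (Alg G)] [Module.Finite k (Alg G)]
    (e : G ≅ cartierDual G), IsMonHom e.hom →
    ∀ (Φ : SchemeOver k) [GrpObj Φ] [IsCommMonObj Φ] [IsAffine Φ.left] [Module.Free k (Alg Φ)] [Module.Finite k (Alg Φ)]
      (φ : Φ ⟶ G) [IsMonHom φ] [IsClosedImmersion φ.left],
    (∀ ⦃T : SchemeOver k⦄ (x : T ⟶ G), (∃ c : T ⟶ annihilator φ, c ≫ (annihilatorι φ ≫ e.inv) = x) ↔ ∃ s : T ⟶ Φ, s ≫ φ = x) →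
    ∀ (εW ε𝒢 : G ⟶ G) [IsMonHom εW] [IsMonHom ε𝒢],
    εW ≫ εW = εW → ε𝒢 ≫ ε𝒢 = ε𝒢 →
    ε𝒢 ≫ e.hom = e.hom ≫ cartierDualMap εW → εW ≫ e.hom = e.hom ≫ cartierDualMap ε𝒢 →
    (∃ t : Φ ⟶ Φ, t ≫ φ = φ ≫ ε𝒢) →
    ∀ (W : SchemeOver k) [GrpObj W] [IsCommMonObj W] [IsAffine W.left] [Module.Free k (Alg W)] [Module.Finite k (Alg W)]
      (jW : W ⟶ G) [IsMonHom jW] [IsClosedImmersion jW.left]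
      (_hW : ∀ ⦃T : SchemeOver k⦄ (x : T ⟶ G), (∃ s : T ⟶ W, s ≫ jW = x) ↔ x ≫ εW = x)
      (𝒢l : SchemeOver k) [GrpObj 𝒢l] [IsCommMonObj 𝒢l] [IsAffine 𝒢l.left] [Module.Free k (Alg 𝒢l)] [Module.Finite k (Alg 𝒢l)]
      (j𝒢 : 𝒢l ⟶ G) [IsMonHom j𝒢] [IsClosedImmersion j𝒢.left]
      (_h𝒢 : ∀ ⦃T : SchemeOver k⦄ (x : T ⟶ G), (∃ s : T ⟶ 𝒢l, s ≫ j𝒢 = x) ↔ x ≫ ε𝒢 = x)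
      (Φ𝒢 : SchemeOver k) [GrpObj Φ𝒢] [IsCommMonObj Φ𝒢] [IsAffine Φ𝒢.left] [Module.Free k (Alg Φ𝒢)] [Module.Finite k (Alg Φ𝒢)]
      (φ𝒢 : Φ𝒢 ⟶ 𝒢l) [IsMonHom φ𝒢] [IsClosedImmersion φ𝒢.left]
      (_hΦ𝒢 : ∀ ⦃T : SchemeOver k⦄ (y : T ⟶ 𝒢l), (∃ s : T ⟶ Φ𝒢, s ≫ φ𝒢 = y) ↔ ∃ s' : T ⟶ Φ, s' ≫ φ = y ≫ j𝒢),
    ∃ eW : W ≅ cartierDual 𝒢l, IsMonHom eW.hom ∧ jW ≫ e.hom ≫ cartierDualMap j𝒢 = eW.hom ∧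
      ∀ ⦃T : SchemeOver k⦄ (x : T ⟶ W),
        (∃ c : T ⟶ annihilator φ𝒢, c ≫ (annihilatorι φ𝒢 ≫ eW.inv) = x) ↔ ∃ s : T ⟶ Φ, s ≫ φ = x ≫ jW

/-- **THE CONSUMER SHAPE (BLF) «BLOCK-LAGRANGIAN FROBENIUS LAW»** = the (R-2) ∕ σ2-G4 BIG-block law at `q`-level, JUNK-PROOF (ρB): over any
field of exponential characteristic `p`, with the `q`-torsion layer `j : G ↪ A` (`hG`), the Frobenius-kernel sublayer `φ : Φ ↪ G` (`hΦ`), layer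
endomorphisms `β a` over `act a = ι(a)`, an involution `star`, a HYPOTHESISED hermitian perfect duality `e₀ : G ≅ G^D` for which `Φ^⊥ = Φ` (supplied by
the `λ`-Weil organ (CN′)+(ISO-F) of the module docstring), and conjugate block idempotents `εu, εū ∈ O` (`star εu = εū`, `star εū = εu`, `β` of each idempotent, `A[F_q]` stable under `β εu`) and
the blocks `W` (fixed layer of `β εū`, the `ū`-block of `A[q]`), `𝒢l` (fixed layer of `β εu`) and `Φ𝒢 = A[F_q] ∩ 𝒢l` (= `kerF x̄`, D3, order
`q`): there is a perfect duality `eW : W ≅ (𝒢l)^D` induced by a hermitian `e` on `A[q]` such that **a `T`-point `x` of `W` is killed by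
`F^{(r)}_{A∕k}` iff it lies in the `eW`-annihilator of `A[F_q] ∩ 𝒢l`** — «`Ker F_q ∩ W[q] = (kerF x̄)^{⊥}`», i.e. `[ϖ̄^{d−1}]⁻¹((kerF x̄)^{⊥,ϖ})`
at the `ϖ`-level (memo §0; the layer shift is left to ED. 2 ∕ the consumer).  For the CM factor (`A[F_q] ∩ 𝒢l = 1`): `Ker F_q ⊇ W[q]`.
[cite: MumfordAV1970, §15 Thm. 1 (p. 143), §20 (I) (p. 189)] [cite: Oda1969, Cor. 1.3] [cite: Tate1997FiniteFlatGroupSchemes, §(3.8) p. 146] -/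
def BlockLagrangianFrobenius : Prop :=
  ∀ ⦃k : Type u⦄ [Field k] (p : ℕ) [ExpChar k p] (r : ℕ) (A : AbelianVariety k)
    (G : SchemeOver k) [GrpObj G] [IsCommMonObj G] [IsAffine G.left] [Module.Free k (Alg G)] [Module.Finite k (Alg G)]
    (j : G ⟶ A.X) [IsMonHom j] [IsClosedImmersion j.left]
    (_hG : ∀ ⦃T : SchemeOver k⦄ (t : T ⟶ A.X), (∃ s : T ⟶ G, s ≫ j = t) ↔ t ≫ ((((p ^ r : ℕ) : ℤ) • 𝟙 A).hom.hom.hom) = 1)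
    (Φ : SchemeOver k) [GrpObj Φ] [IsCommMonObj Φ] [IsAffine Φ.left] [Module.Free k (Alg Φ)] [Module.Finite k (Alg Φ)]
    (φ : Φ ⟶ G) [IsMonHom φ] [IsClosedImmersion φ.left]
    (_hΦ : ∀ ⦃T : SchemeOver k⦄ (t : T ⟶ G), (∃ s : T ⟶ Φ, s ≫ φ = t) ↔ (t ≫ j) ≫ (A.relFrobenius p r).hom.hom.hom = 1)
    (O : Type) [CommRing O] (star : O →+* O) (act : O → (A ⟶ A)) (β : O → (G ⟶ G)) [∀ a, IsMonHom (β a)]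
    (_hβ : ∀ a, β a ≫ j = j ≫ (act a).hom.hom.hom)
    (e₀ : G ≅ cartierDual G), IsMonHom e₀.hom →
    (∀ a : O, β (star a) ≫ e₀.hom = e₀.hom ≫ cartierDualMap (β a)) →
    (∀ ⦃T : SchemeOver k⦄ (x : T ⟶ G), (∃ c : T ⟶ annihilator φ, c ≫ (annihilatorι φ ≫ e₀.inv) = x) ↔ ∃ s : T ⟶ Φ, s ≫ φ = x) →
    ∀ (εu εū : O), star εu = εū → star εū = εu → β εū ≫ β εū = β εū → β εu ≫ β εu = β εu →
    ∀ (W : SchemeOver k) [GrpObj W] [IsCommMonObj W] [IsAffine W.left] [Module.Free k (Alg W)] [Module.Finite k (Alg W)]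
      (jW : W ⟶ G) [IsMonHom jW] [IsClosedImmersion jW.left]
      (_hW : ∀ ⦃T : SchemeOver k⦄ (x : T ⟶ G), (∃ s : T ⟶ W, s ≫ jW = x) ↔ x ≫ β εū = x)
      (𝒢l : SchemeOver k) [GrpObj 𝒢l] [IsCommMonObj 𝒢l] [IsAffine 𝒢l.left] [Module.Free k (Alg 𝒢l)] [Module.Finite k (Alg 𝒢l)]
      (j𝒢 : 𝒢l ⟶ G) [IsMonHom j𝒢] [IsClosedImmersion j𝒢.left]
      (_h𝒢 : ∀ ⦃T : SchemeOver k⦄ (x : T ⟶ G), (∃ s : T ⟶ 𝒢l, s ≫ j𝒢 = x) ↔ x ≫ β εu = x)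
      (Φ𝒢 : SchemeOver k) [GrpObj Φ𝒢] [IsCommMonObj Φ𝒢] [IsAffine Φ𝒢.left] [Module.Free k (Alg Φ𝒢)] [Module.Finite k (Alg Φ𝒢)]
      (φ𝒢 : Φ𝒢 ⟶ 𝒢l) [IsMonHom φ𝒢] [IsClosedImmersion φ𝒢.left]
      (_hΦ𝒢 : ∀ ⦃T : SchemeOver k⦄ (y : T ⟶ 𝒢l), (∃ s : T ⟶ Φ𝒢, s ≫ φ𝒢 = y) ↔ ∃ s' : T ⟶ Φ, s' ≫ φ = y ≫ j𝒢),
    ∃ eW : W ≅ cartierDual 𝒢l, IsMonHom eW.hom ∧ jW ≫ e₀.hom ≫ cartierDualMap j𝒢 = eW.hom ∧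
      ∀ ⦃T : SchemeOver k⦄ (x : T ⟶ W),
        (∃ c : T ⟶ annihilator φ𝒢, c ≫ (annihilatorι φ𝒢 ≫ eW.inv) = x) ↔ ((x ≫ jW) ≫ j) ≫ (A.relFrobenius p r).hom.hom.hom = 1

/-! ## §2 The socket `stub_BR` (statement-first) — CLOSED-PROVED by the ★ organ `CartierDualBlockReduction` (p846608) -/

/-- `stub_BR` — the letter (BR), CLOSED: one `exact` on ★ `AffineGroupScheme.blockReduction` (B-p04 (g38), p846608; body token-identical to
`BlockReduction`). [cite: Tate1997FiniteFlatGroupSchemes, §(3.8) pp. 145–146] -/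
theorem stub_BR : BlockReduction.{u} := by
  exact AffineGroupScheme.blockReduction

/-! ## §3 Head — kernel-checked composition `(BR) → (BLF)` (no `sorry` anywhere in this file) -/

/-- **`blockLagrangianFrobenius_of_line : (BR) → (BLF)`**: read the two adjunctions of the conjugate idempotents off the hermitianity hypothesis
(`star εu = εū`, `star εū = εu`), prove the stability of `A[F_q]` under `ι(εu)` from ★ (BLK-nat) `AbelianVariety.comp_end_comp_relFrobenius_eq_one`
and the point descriptions `hΦ`, `hβ`, apply (BR) to the hypothesised Lagrangian duality `e₀`, and rewrite the sublayer membership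
`∃ s, s ≫ φ = x ≫ jW` as «killed by `F^{(r)}_{A∕k}`» by `hΦ`. [cite: MumfordAV1970, §15 (p. 146), §20 (I) (p. 189)] -/
theorem blockLagrangianFrobenius_of_line (hBR : BlockReduction.{u}) : BlockLagrangianFrobenius.{u} := by
  intro k _ p _ r A G _ _ _ _ _ j _ _ _hG Φ _ _ _ _ _ φ _ _ hΦ O _ star act β _ hβ e₀ he₀ hherm hlag εu εū hu hū hidemW hidem𝒢
    W _ _ _ _ _ jW _ _ hW 𝒢l _ _ _ _ _ j𝒢 _ _ h𝒢 Φ𝒢 _ _ _ _ _ φ𝒢 _ _ hΦ𝒢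
  have h1 : β εu ≫ e₀.hom = e₀.hom ≫ cartierDualMap (β εū) := by
    have h := hherm εū
    rw [hū] at h
    exact h
  have h2 : β εū ≫ e₀.hom = e₀.hom ≫ cartierDualMap (β εu) := by
    have h := hherm εu
    rw [hu] at h
    exact h
  have hφF : (φ ≫ j) ≫ (A.relFrobenius p r).hom.hom.hom = 1 := (hΦ φ).mp ⟨𝟙 _, Category.id_comp _⟩
  have hstab : ∃ t : Φ ⟶ Φ, t ≫ φ = φ ≫ β εu := by
    refine (hΦ (φ ≫ β εu)).mpr ?_
    have h := Literature.AlgebraicGeometry.Motives.AbelianVariety.comp_end_comp_relFrobenius_eq_one p r A (act εu) (φ ≫ j) hφF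
    rw [Category.assoc φ (β εu) j, hβ εu, ← Category.assoc φ j]
    exact h
  obtain ⟨eW, heW, hcomp, hpts⟩ :=
    hBR G e₀ he₀ Φ φ hlag (β εū) (β εu) hidemW hidem𝒢 h1 h2 hstab W jW hW 𝒢l j𝒢 h𝒢 Φ𝒢 φ𝒢 hΦ𝒢
  refine ⟨eW, heW, hcomp, fun T x => ?_⟩
  rw [hpts x, hΦ]

/-- The head on the (closed) socket: (BLF) HOLDS on this line — `--axioms` of this declaration = {propext, Classical.choice, Quot.sound}
(no `sorryAx`: (BR) is paid by ★ p846608). [cite: MumfordAV1970, §20 (I) (p. 189)] -/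
theorem blockLagrangianFrobenius_holds : BlockLagrangianFrobenius.{u} :=
  blockLagrangianFrobenius_of_line stub_BR

end Literature.AlgebraicGeometry.Motives.AbelianVarietyFrobeniusBlockLagrangian

end
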